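import Mathlib
import Literature.NumberTheory.LFunctions.MertensFormula
import Literature.NumberTheory.Sieve.IwaniecAlmostPrimesProp1Corollary
import HarnessLib

/-!
# The split-mass bound (stub `stub_splitMassBound`, line `split-mass-middle-prime`,
crux `SplitBlockJacobi`, stmt-Parity-11583)

For `θ ∈ (1/2, 1)` let `N_θ(x)` be the number of triples `(t, Q, Q′)` with `1 ≤ t ≤ x` and
`Q < Q′` prime factors of `t² + 1`, `Q > x^θ`. We prove
`N_θ(x) ≤ 60 · (1 − θ)/(2θ − 1) · x` eventually in `x`, with the ABSOLUTE constant `60`.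

Proof (elementary, no sieve). In such a triple `Q·Q′ ∣ t² + 1 ≤ x² + 1`, so `Q ≤ x`; and a
value `t² + 1 ≤ x² + 1 < x³ < x^{6θ}` (`x ≥ 2`) has at most five prime factors `> x^θ`. Hence
`N_θ(x) ≤ 5 · Σ_{x^θ < Q ≤ x prime} #{1 ≤ t ≤ x : Q ∣ t² + 1} ≤ 5 · Σ 4x/Q`
(a period `Q` contains `ρ(Q) ≤ 2` roots of `−1`, Iwaniec's trivial remainder estimate), and by
Mertens' second theorem with rate (`|Σ_{p ≤ y} 1/p − log log y − M| ≤ 8/log y`)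
`Σ_{x^θ < Q ≤ x} 1/Q ≤ −log θ + 8/log x + 8/(θ log x) ≤ 2(1 − θ) + 24/log x ≤ 3(1 − θ)`
once `log x ≥ 24/(1 − θ)`. Finally `1 − θ ≤ (1 − θ)/(2θ − 1)` as `0 < 2θ − 1 ≤ 1`.
-/

noncomputable section

open Filter Finset Asymptotics
open scoped Classical

namespace Summit.Parity.BatemanHorn.Cruxes.SplitBlockJacobi.SplitMassMiddlePrime

open Literature.NumberTheory.LFunctions.Mertens Literature.NumberTheory.Sieve.Iwaniec1978

/-- In a pair `Q < Q′` of prime factors of `t² + 1`, `1 ≤ t ≤ x`, the smaller prime is `≤ x`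
(`Q² < Q·Q′ ≤ t² + 1 ≤ x² + 1`); hence the pair set at `t` lies in `B(t) × Big(t)` with
`B(t)` the prime factors in `(x^θ, x]` and `Big(t)` those `> x^θ`. -/
theorem card_pairs_le_card_mul (θ : ℝ) (x t : ℕ) (ht : t ∈ Icc 1 x) :
    (((t ^ 2 + 1).primeFactors ×ˢ (t ^ 2 + 1).primeFactors).filter
        (fun q : ℕ × ℕ => (x : ℝ) ^ θ < (q.1 : ℝ) ∧ q.1 < q.2)).card ≤
      ((t ^ 2 + 1).primeFactors.filter (fun p : ℕ => (x : ℝ) ^ θ < p ∧ p ≤ x)).card *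
        ((t ^ 2 + 1).primeFactors.filter (fun p : ℕ => (x : ℝ) ^ θ < p)).card := by
  rw [← Finset.card_product]
  refine Finset.card_le_card fun q hq => ?_
  rw [Finset.mem_filter, Finset.mem_product] at hq
  obtain ⟨⟨hQ, hQ'⟩, hθQ, hQQ'⟩ := hq
  rw [Finset.mem_product, Finset.mem_filter, Finset.mem_filter]
  have hQp := Nat.prime_of_mem_primeFactors hQ
  have hQ'p := Nat.prime_of_mem_primeFactors hQ'
  have hdvd : q.1 * q.2 ∣ t ^ 2 + 1 :=
    Nat.Coprime.mul_dvd_of_dvd_of_dvd ((Nat.coprime_primes hQp hQ'p).mpr hQQ'.ne)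
      (Nat.dvd_of_mem_primeFactors hQ) (Nat.dvd_of_mem_primeFactors hQ')
  have hle : q.1 * q.2 ≤ t ^ 2 + 1 := Nat.le_of_dvd (Nat.succ_pos _) hdvd
  have htx : t ≤ x := (Finset.mem_Icc.mp ht).2
  have hQx : q.1 ≤ x := by
    by_contra h
    push Not at h
    have h1 : x + 1 ≤ q.1 := h
    have h2 : x + 2 ≤ q.2 := by omega
    have h3 : (x + 1) * (x + 2) ≤ q.1 * q.2 := Nat.mul_le_mul h1 h2
    have h4 : t ^ 2 ≤ x ^ 2 := Nat.pow_le_pow_left htx 2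
    nlinarith
  have hθQ' : (x : ℝ) ^ θ < (q.2 : ℝ) := hθQ.trans (by exact_mod_cast hQQ')
  exact ⟨⟨hQ, hθQ, hQx⟩, hQ', hθQ'⟩

/-- For `x ≥ 2` and `θ > 1/2`, a value `t² + 1` with `t ≤ x` has at most five prime factors
exceeding `x^θ`: their product divides `t² + 1 ≤ x² + 1 < x³ < x^{6θ}`. -/
theorem card_bigFactors_le_five {θ : ℝ} (hθ : 1 / 2 < θ) {x t : ℕ} (hx : 2 ≤ x)
    (ht : t ∈ Icc 1 x) :
    ((t ^ 2 + 1).primeFactors.filter (fun p : ℕ => (x : ℝ) ^ θ < p)).card ≤ 5 := by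
  by_contra hcon
  push Not at hcon
  set S := (t ^ 2 + 1).primeFactors.filter (fun p : ℕ => (x : ℝ) ^ θ < p) with hS
  have hx1 : (1 : ℝ) < x := by exact_mod_cast hx
  have hx0 : (0 : ℝ) ≤ x := Nat.cast_nonneg x
  have hxθ1 : (1 : ℝ) ≤ (x : ℝ) ^ θ := Real.one_le_rpow hx1.le (by linarith)
  -- the product of the primes in `S` divides `t² + 1`
  have hdvd : ∏ p ∈ S, p ∣ t ^ 2 + 1 :=
    (Finset.prod_dvd_prod_of_subset _ _ _ (Finset.filter_subset _ _)).trans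
      (Nat.prod_primeFactors_dvd (t ^ 2 + 1))
  have hprod_le : ((∏ p ∈ S, p : ℕ) : ℝ) ≤ (x : ℝ) ^ 2 + 1 := by
    have h1 : ∏ p ∈ S, p ≤ t ^ 2 + 1 := Nat.le_of_dvd (Nat.succ_pos _) hdvd
    have htx : t ≤ x := (Finset.mem_Icc.mp ht).2
    have h2 : t ^ 2 + 1 ≤ x ^ 2 + 1 := by gcongr
    exact_mod_cast h1.trans h2
  -- while it is at least `(x^θ)^6 = x^{6θ} > x^3 ≥ x² + 1`
  have hlow : ((x : ℝ) ^ θ) ^ 6 ≤ ((∏ p ∈ S, p : ℕ) : ℝ) := by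
    rw [Nat.cast_prod]
    calc ((x : ℝ) ^ θ) ^ 6 ≤ ((x : ℝ) ^ θ) ^ S.card := pow_le_pow_right₀ hxθ1 hcon
      _ = ∏ _p ∈ S, (x : ℝ) ^ θ := (Finset.prod_const _).symm
      _ ≤ ∏ p ∈ S, (p : ℝ) :=
        Finset.prod_le_prod (fun _ _ => by positivity) fun p hp => (Finset.mem_filter.mp hp).2.le
  have hpow : (x : ℝ) ^ 3 < ((x : ℝ) ^ θ) ^ 6 := by
    rw [← Real.rpow_mul_natCast hx0]
    calc (x : ℝ) ^ 3 = (x : ℝ) ^ ((3 : ℕ) : ℝ) := (Real.rpow_natCast _ 3).symm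
      _ < (x : ℝ) ^ (θ * (6 : ℕ)) :=
        Real.rpow_lt_rpow_of_exponent_lt hx1 (by push_cast; linarith)
  have hx3 : (x : ℝ) ^ 2 + 1 ≤ (x : ℝ) ^ 3 := by
    have : (2 : ℝ) ≤ x := by exact_mod_cast hx
    nlinarith
  linarith

/-- For a prime `Q ≤ x`: `#{1 ≤ t ≤ x : Q ∣ t² + 1} ≤ ρ(Q)·x/Q + ρ(Q) ≤ 4x/Q` (Iwaniec's trivial
remainder estimate `|r(𝒜; Q)| ≤ ρ(Q)` and `ρ(Q) ≤ 2`). -/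
theorem card_dvd_sq_add_one_le {x Q : ℕ} (hQ : Q.Prime) (hQx : Q ≤ x) :
    ((((Icc 1 x).filter (fun t : ℕ => Q ∣ t ^ 2 + 1)).card : ℕ) : ℝ) ≤ 4 * (x : ℝ) / Q := by
  have hQ0 : Q ≠ 0 := hQ.ne_zero
  have hQpos : (0 : ℝ) < Q := by exact_mod_cast hQ.pos
  have hx0 : (0 : ℝ) ≤ (x : ℝ) := Nat.cast_nonneg x
  have h := abs_rem_le_rho hx0 hQ0
  have hρ : (rho Q : ℝ) ≤ 2 := by exact_mod_cast rho_le_two hQ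
  have hcc : congrCount (x : ℝ) Q = ((Icc 1 x).filter (fun t : ℕ => Q ∣ t ^ 2 + 1)).card := by
    rw [congrCount, Nat.floor_natCast]
  rw [rem, hcc] at h
  have h1 := (abs_le.mp h).2
  have hxQ : (1 : ℝ) ≤ (x : ℝ) / Q := by
    rw [le_div_iff₀ hQpos, one_mul]; exact_mod_cast hQx
  have h2 : (rho Q : ℝ) * x / Q ≤ 2 * x / Q := by
    rw [mul_div_assoc, mul_div_assoc]
    exact mul_le_mul_of_nonneg_right hρ (by positivity)
  have h3 : (2 : ℝ) * 1 ≤ 2 * ((x : ℝ) / Q) := mul_le_mul_of_nonneg_left hxQ (by norm_num)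
  calc ((((Icc 1 x).filter (fun t : ℕ => Q ∣ t ^ 2 + 1)).card : ℕ) : ℝ)
      ≤ (rho Q : ℝ) * x / Q + rho Q := by linarith
    _ ≤ 2 * x / Q + 2 * ((x : ℝ) / Q) := by linarith
    _ = 4 * (x : ℝ) / Q := by ring

/-- Mertens' second theorem with rate, differenced over `(x^θ, x]`:
`Σ_{x^θ < Q ≤ x prime} 1/Q ≤ −log θ + 8/log x + 8/(θ log x) ≤ 2(1 − θ) + 24/log x`
for `1/2 < θ < 1` and `x^θ ≥ 2`. -/
theorem sum_inv_primes_sdiff_le {θ : ℝ} (hθ : 1 / 2 < θ) (hθ1 : θ < 1) {x : ℕ}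
    (hxθ : 2 ≤ (x : ℝ) ^ θ) :
    ∑ Q ∈ Nat.primesLE x \ Nat.primesLE ⌊(x : ℝ) ^ θ⌋₊, (Q : ℝ)⁻¹ ≤
      2 * (1 - θ) + 24 / Real.log x := by
  have hθ0 : 0 < θ := by linarith
  have hx0 : (0 : ℝ) ≤ x := Nat.cast_nonneg x
  -- `x ≥ x^θ ≥ 2`
  have hx1 : (1 : ℝ) < x := by
    by_contra h
    push Not at h
    have : (x : ℝ) ^ θ ≤ 1 := Real.rpow_le_one hx0 h hθ0.le
    linarith
  have hxθx : (x : ℝ) ^ θ ≤ x := by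
    calc (x : ℝ) ^ θ ≤ (x : ℝ) ^ (1 : ℝ) := Real.rpow_le_rpow_of_exponent_le hx1.le hθ1.le
      _ = x := Real.rpow_one _
  have hx2 : (2 : ℝ) ≤ x := hxθ.trans hxθx
  have hsub : Nat.primesLE ⌊(x : ℝ) ^ θ⌋₊ ⊆ Nat.primesLE x := by
    apply Nat.primesLE_mono
    calc ⌊(x : ℝ) ^ θ⌋₊ ≤ ⌊((x : ℕ) : ℝ)⌋₊ := Nat.floor_le_floor hxθx
      _ = x := Nat.floor_natCast x
  rw [Finset.sum_sdiff_eq_sub hsub]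
  have hPx : primeRecipSum (x : ℝ) = ∑ Q ∈ Nat.primesLE x, (Q : ℝ)⁻¹ := by
    rw [primeRecipSum, Nat.floor_natCast]
  have hPθ : primeRecipSum ((x : ℝ) ^ θ) = ∑ Q ∈ Nat.primesLE ⌊(x : ℝ) ^ θ⌋₊, (Q : ℝ)⁻¹ := rfl
  rw [← hPx, ← hPθ]
  have h1 := (abs_le.mp (abs_primeRecipSum_sub_le hx2)).2
  have h2 := (abs_le.mp (abs_primeRecipSum_sub_le hxθ)).1
  have hlogx : 0 < Real.log x := Real.log_pos hx1
  have hlogθ : Real.log ((x : ℝ) ^ θ) = θ * Real.log x := Real.log_rpow (by linarith) θ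
  have hll : Real.log (Real.log ((x : ℝ) ^ θ)) = Real.log θ + Real.log (Real.log x) := by
    rw [hlogθ, Real.log_mul hθ0.ne' hlogx.ne']
  -- `-log θ ≤ 1/θ - 1 = (1 - θ)/θ ≤ 2(1 - θ)`
  have hinv2 : θ⁻¹ ≤ 2 := by
    rw [inv_le_comm₀ hθ0 two_pos]; linarith
  have hneglog : -Real.log θ ≤ 2 * (1 - θ) := by
    have h := Real.one_sub_inv_le_log_of_pos hθ0
    have hkey : θ⁻¹ - 1 = (1 - θ) * θ⁻¹ := by field_simp
    have hmul : (1 - θ) * θ⁻¹ ≤ (1 - θ) * 2 :=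
      mul_le_mul_of_nonneg_left hinv2 (sub_nonneg.mpr hθ1.le)
    linarith
  -- `8 / log x^θ = 8/(θ log x) ≤ 16 / log x`
  have hrate : 8 / Real.log ((x : ℝ) ^ θ) ≤ 16 / Real.log x := by
    rw [hlogθ, div_le_div_iff₀ (by positivity) hlogx]
    nlinarith [mul_pos (sub_pos.mpr hθ) hlogx]
  have h24 : 8 / Real.log x + 16 / Real.log x = 24 / Real.log x := by ring
  linarith [hll]

/-- **STUB 1 of line `split-mass-middle-prime` (`SplitMassBound`), PROVED with `C = 60`:**
for every `θ ∈ (1/2, 1)`, eventually in `x`,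
`#{(t, Q, Q′) : 1 ≤ t ≤ x, Q < Q′ ∈ primeFactors(t²+1), Q > x^θ} ≤ 60·(1−θ)/(2θ−1)·x`.
Assembly of `card_pairs_le_card_mul`, `card_bigFactors_le_five`, Fubini over `(t, Q)`,
`card_dvd_sq_add_one_le` and `sum_inv_primes_sdiff_le`, on the eventual range
`x ≥ 2`, `x^θ ≥ 2`, `log x ≥ 24/(1 − θ)`. -/
theorem stub_splitMassBound :
    ∃ C : ℝ, 0 < C ∧ ∀ θ : ℝ, 1 / 2 < θ → θ < 1 →
      ∀ᶠ x : ℕ in Filter.atTop,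
        ((∑ t ∈ Finset.Icc 1 x, (((t ^ 2 + 1).primeFactors ×ˢ (t ^ 2 + 1).primeFactors).filter
            (fun q : ℕ × ℕ => (x : ℝ) ^ θ < (q.1 : ℝ) ∧ q.1 < q.2)).card : ℕ) : ℝ)
          ≤ C * ((1 - θ) / (2 * θ - 1)) * x := by
  refine ⟨60, by norm_num, fun θ hθ hθ1 => ?_⟩
  have hθ0 : 0 < θ := by linarith
  have h1θ : 0 < 1 - θ := by linarith
  have ev1 : ∀ᶠ x : ℕ in atTop, 2 ≤ x := eventually_ge_atTop 2
  have ev2 : ∀ᶠ x : ℕ in atTop, 2 ≤ (x : ℝ) ^ θ :=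
    ((tendsto_rpow_atTop hθ0).comp tendsto_natCast_atTop_atTop).eventually_ge_atTop 2
  have ev3 : ∀ᶠ x : ℕ in atTop, 24 / (1 - θ) ≤ Real.log x :=
    (Real.tendsto_log_atTop.comp tendsto_natCast_atTop_atTop).eventually_ge_atTop _
  filter_upwards [ev1, ev2, ev3] with x hx2 hxθ hlog
  -- the primes in `(x^θ, x]`
  set P : Finset ℕ := Nat.primesLE x \ Nat.primesLE ⌊(x : ℝ) ^ θ⌋₊ with hP
  have hx0 : (0 : ℝ) ≤ (x : ℝ) ^ θ := by positivity
  -- `B(t) ⊆ {Q ∈ P : Q ∣ t² + 1}`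
  have hB : ∀ t ∈ Icc 1 x,
      ((t ^ 2 + 1).primeFactors.filter (fun p : ℕ => (x : ℝ) ^ θ < p ∧ p ≤ x)).card ≤
        (P.filter (fun Q => Q ∣ t ^ 2 + 1)).card := by
    intro t ht
    refine Finset.card_le_card fun p hp => ?_
    rw [Finset.mem_filter] at hp ⊢
    obtain ⟨hpf, hθp, hpx⟩ := hp
    have hpp := Nat.prime_of_mem_primeFactors hpf
    refine ⟨?_, Nat.dvd_of_mem_primeFactors hpf⟩
    rw [hP, Finset.mem_sdiff, Nat.mem_primesLE, Nat.mem_primesLE]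
    refine ⟨⟨hpx, hpp⟩, fun h => ?_⟩
    have : ⌊(x : ℝ) ^ θ⌋₊ < p := (Nat.floor_lt hx0).mpr hθp
    omega
  -- the integer bound `N ≤ 5 · Σ_{Q ∈ P} #{1 ≤ t ≤ x : Q ∣ t² + 1}` (Fubini over `(t, Q)`)
  have hN : (∑ t ∈ Icc 1 x, (((t ^ 2 + 1).primeFactors ×ˢ (t ^ 2 + 1).primeFactors).filter
        (fun q : ℕ × ℕ => (x : ℝ) ^ θ < (q.1 : ℝ) ∧ q.1 < q.2)).card) ≤
      5 * ∑ Q ∈ P, ((Icc 1 x).filter (fun t : ℕ => Q ∣ t ^ 2 + 1)).card := by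
    calc (∑ t ∈ Icc 1 x, (((t ^ 2 + 1).primeFactors ×ˢ (t ^ 2 + 1).primeFactors).filter
          (fun q : ℕ × ℕ => (x : ℝ) ^ θ < (q.1 : ℝ) ∧ q.1 < q.2)).card)
        ≤ ∑ t ∈ Icc 1 x, (P.filter (fun Q => Q ∣ t ^ 2 + 1)).card * 5 := by
          refine Finset.sum_le_sum fun t ht => (card_pairs_le_card_mul θ x t ht).trans ?_
          exact Nat.mul_le_mul (hB t ht) (card_bigFactors_le_five hθ hx2 ht)
      _ = 5 * ∑ Q ∈ P, ((Icc 1 x).filter (fun t : ℕ => Q ∣ t ^ 2 + 1)).card := by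
          rw [← Finset.sum_mul, mul_comm]
          congr 1
          simp only [Finset.card_filter]
          exact Finset.sum_comm
  -- the real bound
  have hPQ : ∀ Q ∈ P, Q.Prime ∧ Q ≤ x := fun Q hQ => by
    rw [hP, Finset.mem_sdiff, Nat.mem_primesLE] at hQ
    exact ⟨hQ.1.2, hQ.1.1⟩
  have hsum : (∑ Q ∈ P, ((((Icc 1 x).filter (fun t : ℕ => Q ∣ t ^ 2 + 1)).card : ℕ) : ℝ)) ≤
      ∑ Q ∈ P, 4 * (x : ℝ) / Q :=
    Finset.sum_le_sum fun Q hQ => card_dvd_sq_add_one_le (hPQ Q hQ).1 (hPQ Q hQ).2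
  have hmertens := sum_inv_primes_sdiff_le hθ hθ1 hxθ
  have hlogpos : 0 < Real.log x := by
    have : 0 < 24 / (1 - θ) := by positivity
    linarith
  have h24 : 24 / Real.log x ≤ 1 - θ := by
    rw [div_le_iff₀ hlogpos]
    rw [div_le_iff₀ h1θ] at hlog
    linarith
  have hxR : (0 : ℝ) ≤ x := Nat.cast_nonneg x
  have hfrac : (1 - θ) ≤ (1 - θ) / (2 * θ - 1) := by
    rw [le_div_iff₀ (by linarith)]
    nlinarith
  calc ((∑ t ∈ Icc 1 x, (((t ^ 2 + 1).primeFactors ×ˢ (t ^ 2 + 1).primeFactors).filter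
        (fun q : ℕ × ℕ => (x : ℝ) ^ θ < (q.1 : ℝ) ∧ q.1 < q.2)).card : ℕ) : ℝ)
      ≤ ((5 * ∑ Q ∈ P, ((Icc 1 x).filter (fun t : ℕ => Q ∣ t ^ 2 + 1)).card : ℕ) : ℝ) := by
        exact_mod_cast hN
    _ = 5 * ∑ Q ∈ P, ((((Icc 1 x).filter (fun t : ℕ => Q ∣ t ^ 2 + 1)).card : ℕ) : ℝ) := by
        push_cast; ring
    _ ≤ 5 * ∑ Q ∈ P, 4 * (x : ℝ) / Q := mul_le_mul_of_nonneg_left hsum (by norm_num)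
    _ = 20 * x * ∑ Q ∈ P, (Q : ℝ)⁻¹ := by
        rw [Finset.mul_sum, Finset.mul_sum]
        refine Finset.sum_congr rfl fun Q _ => ?_
        ring
    _ ≤ 20 * x * (2 * (1 - θ) + 24 / Real.log x) :=
        mul_le_mul_of_nonneg_left hmertens (by positivity)
    _ ≤ 20 * x * (3 * (1 - θ)) := mul_le_mul_of_nonneg_left (by linarith) (by positivity)
    _ = 60 * (1 - θ) * x := by ring
    _ ≤ 60 * ((1 - θ) / (2 * θ - 1)) * x := by
        have : 60 * (1 - θ) ≤ 60 * ((1 - θ) / (2 * θ - 1)) := by linarith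
        exact mul_le_mul_of_nonneg_right this hxR

end Summit.Parity.BatemanHorn.Cruxes.SplitBlockJacobi.SplitMassMiddlePrime

end
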